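import Summits.AtomisticToContinuum.Crystallization.Theorems.ReggeStarCoercivityDefectFreeCrystallizesGoodCharts
import Summits.AtomisticToContinuum.Crystallization.Theorems.ReggeStarCoercivityDefectFreeCrystallizesJunkStrippingEnergy
import Summits.AtomisticToContinuum.Crystallization.Theorems.ReggeStarCoercivityDefectFreeCrystallizesFunnelCovering
import Summits.AtomisticToContinuum.Crystallization.Theorems.PalmUnimodularRigidityShellsToBarlowChartCubicGrowth
import Literature.MeasureTheory.Covering.VolumePacking

/-!
# Connectivity and cubic growth of the window graph of a rescaled everywhere-`SetGood` set
# (stub R1b `stub_goodGrowth` of line `palm-good-law`, crux stmt-AtomisticToContinuum-13603)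

Stub `stub_goodGrowth` of the skeleton `Cruxes/DefectFreeCrystallizes/Lines/palm_good_law.lean`:
if every point of `S ⊆ ℝ³` is `SetGood` in `S` (`Theorems.PalmGoodLaw.SetGood`), then in the
window graph (bond window `(0, 28/25]`, crux 9227's `windowGraph`) of the rescaled set
`S' = (19/20) • S` any two points `(19/20) • x`, `(19/20) • y` (`x, y ∈ S`) are joined by a walk,
and the graph balls about `(19/20) • x` eventually hold `≥ C·n³` points.

Template: `Theorems/PalmUnimodularRigidityShellsToBarlowChartCubicGrowth.lean` (the same
statement for the `1 %` class).

Proof.  DICTIONARY (`bond_smul_iff`): by radial pinning (`GoodCharts.dist_le_of_setGood`: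
bonded pairs of `S` are at distance `≤ 231/200`) the bond relation `0 < d < 6/5` of `S` is
exactly the bond window `0 < d' ≤ 28/25` of `S'`, so every bond of `S` is an edge of
`windowGraph S'` (`adj_smul`).  GREEDY STEPS (`exists_bond_step`, from
`FunnelCovering.shellDir`): from a `SetGood` point `x` towards a target `p` at distance `r`
there is `z ∈ S` bonded to `x` with `dist(z, p)² ≤ r² − 1.314·a·r + 1.1025·a²`
(`a ∈ [9/10, 11/10]` the scale of `x`), which is `≤ (r − 3/10)²` for `r ≥ 3/2` (`step_far`)
and `< (6/5)²` for `r ≤ 3/2` (`step_near`, so `z` is then bonded to the target `q ∈ S` or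
equal to it).  Hence every `x ∈ S` with `dist(x, q) ≤ 3/2 + 3m/10` is joined to `q` by a
walk of length `≤ m + 2` in `windowGraph S'` (`exists_walk`): connectivity.  COUNTING: `S`
and `S'` are `0.81`-separated (hard core `JunkStrippingEnergy.le_dist_of_setGood`), so their
bounded parts are finite (packing bound, `finite_inter_closedBall`); the window ball of radius
`n` is finite (`walk_mem_and_dist`) and contains the rescaled copy of `S ∩ B(x, R)`,
`R = 3/2 + 3(n−2)/10`; the unit balls about the points of `S ∩ B(x, R)` cover `B(x, R − 1)`
(covering radius `< 1`, `FunnelCovering.stub_funnelCovering`), whence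
`#(S ∩ B(x, R)) ≥ (R − 1)³ ≥ (n/5)³` by volume (`cube_le_ncard`).
-/

noncomputable section

namespace Summit.AtomisticToContinuum.Crystallization.Theorems.PalmGoodLaw.GoodGrowth

open Literature.MathematicalPhysics.StatisticalMechanics Literature.Geometry.DiscreteGeometry
open Summit.AtomisticToContinuum.Crystallization.Theorems.PalmGoodLaw (SetGood)
open Summit.AtomisticToContinuum.Crystallization.Theorems.PalmGoodLaw.GoodCharts
  (dist_le_of_setGood)
open Summit.AtomisticToContinuum.Crystallization.Theorems.PalmGoodLaw.JunkStrippingEnergy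
  (le_dist_of_setGood)
open Summit.AtomisticToContinuum.Crystallization.Theorems.PalmGoodLaw.FunnelCovering
  (shellDir stub_funnelCovering)
open Summit.AtomisticToContinuum.Crystallization.Theorems.PalmUnimodularRigidityShellsToBarlowChart
  (IsBond windowGraph windowBall walk_mem_and_dist)
open MeasureTheory Metric
open scoped ENNReal NNReal Pointwise

/-! ## The rescaling dictionary -/

/-- **The rescaling dictionary**: on an everywhere-`SetGood` set the crux's bond relation
`0 < d < 6/5` is 9227's bond window `0 < d' ≤ 28/25` after rescaling by `19/20`
(`231/200 · 19/20 ≤ 28/25 < 6/5 · 19/20`). [folklore] -/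
theorem bond_smul_iff {S : Set (EuclideanSpace ℝ (Fin 3))} (hS : ∀ x ∈ S, SetGood S x)
    {u v : EuclideanSpace ℝ (Fin 3)} (hu : u ∈ S) (hv : v ∈ S) :
    (0 < dist ((19 / 20 : ℝ) • u) ((19 / 20 : ℝ) • v) ∧
        dist ((19 / 20 : ℝ) • u) ((19 / 20 : ℝ) • v) ≤ 28 / 25) ↔
      (0 < dist u v ∧ dist u v < 6 / 5) := by
  -- adapted from the skeleton `Lines/palm_good_law.lean`
  rw [dist_smul₀, Real.norm_of_nonneg (by norm_num : (0 : ℝ) ≤ 19 / 20)]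
  constructor
  · rintro ⟨h0, h1⟩
    constructor <;> nlinarith [h0, h1]
  · rintro ⟨h0, h1⟩
    have hne : v ≠ u := fun h => by rw [h, dist_self] at h0; exact lt_irrefl _ h0
    have hle : dist v u ≤ 231 / 200 := dist_le_of_setGood (hS u hu) hv hne (by rwa [dist_comm])
    rw [dist_comm] at hle
    constructor <;> nlinarith [h0, hle]

/-- Undoing the rescaling. [folklore] -/
theorem smul_back (x : EuclideanSpace ℝ (Fin 3)) : (20 / 19 : ℝ) • ((19 / 20 : ℝ) • x) = x := by
  rw [smul_smul]; norm_num

/-- The rescaling is injective. [folklore] -/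
theorem smul_injective :
    Function.Injective fun x : EuclideanSpace ℝ (Fin 3) => (19 / 20 : ℝ) • x := by
  intro u v h
  have h' := congrArg (fun y : EuclideanSpace ℝ (Fin 3) => (20 / 19 : ℝ) • y) h
  simpa only [smul_back] using h'

/-- **Hard core of the rescaled set**: distinct points of `(19/20) • S` are `≥ 0.81` apart
(`171/200 · 19/20 = 0.81225`). [folklore] -/
theorem sep_smul {S : Set (EuclideanSpace ℝ (Fin 3))} (hS : ∀ x ∈ S, SetGood S x) :
    ∀ y ∈ (19 / 20 : ℝ) • S, ∀ z ∈ (19 / 20 : ℝ) • S, y ≠ z → (81 / 100 : ℝ) ≤ dist y z := by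
  intro y' hy' z' hz' hne
  obtain ⟨y, hy, rfl⟩ := Set.mem_smul_set.1 hy'
  obtain ⟨z, hz, rfl⟩ := Set.mem_smul_set.1 hz'
  have hyz : y ≠ z := fun h => hne (by rw [h])
  have hd : (171 / 200 : ℝ) ≤ dist y z := le_dist_of_setGood (hS z hz) hy hyz
  rw [dist_smul₀, Real.norm_of_nonneg (by norm_num : (0 : ℝ) ≤ 19 / 20)]
  linarith

/-- **Hard core**: distinct points of an everywhere-`SetGood` set are `≥ 0.81` apart
(indeed `≥ 171/200`). [folklore] -/
theorem sep {S : Set (EuclideanSpace ℝ (Fin 3))} (hS : ∀ x ∈ S, SetGood S x) :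
    ∀ y ∈ S, ∀ z ∈ S, y ≠ z → (81 / 100 : ℝ) ≤ dist y z := by
  intro y hy z hz hne
  have hd : (171 / 200 : ℝ) ≤ dist y z := le_dist_of_setGood (hS z hz) hy hne
  linarith

/-- **Bonds of `S` are edges of the window graph of `(19/20) • S`.** [folklore] -/
theorem adj_smul {S : Set (EuclideanSpace ℝ (Fin 3))} (hS : ∀ x ∈ S, SetGood S x)
    {u v : EuclideanSpace ℝ (Fin 3)} (hu : u ∈ S) (hv : v ∈ S) (hne : u ≠ v)
    (hlt : dist u v < 6 / 5) :
    (windowGraph ((19 / 20 : ℝ) • S)).Adj ((19 / 20 : ℝ) • u) ((19 / 20 : ℝ) • v) := by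
  rw [windowGraph, SimpleGraph.fromRel_adj]
  have hb : IsBond ((19 / 20 : ℝ) • u) ((19 / 20 : ℝ) • v) :=
    (bond_smul_iff hS hu hv).2 ⟨dist_pos.2 hne, hlt⟩
  exact ⟨fun h => hne (smul_injective h),
    Or.inl ⟨Set.smul_mem_smul_set hu, Set.smul_mem_smul_set hv, hb⟩⟩

/-! ## Greedy steps -/

/-- **The greedy bond step.**  From a `SetGood` point `x ∈ S` towards any target `p` there is
`z ∈ S` with `dist(x, z) < 6/5`, `z ≠ x` unless `p = x`, and
`dist(z, p)² ≤ dist(x, p)² − 1.314·a·dist(x, p) + 1.1025·a²` for the scale `a ∈ [9/10, 11/10]`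
of `x`. [folklore] -/
theorem exists_bond_step {S : Set (EuclideanSpace ℝ (Fin 3))} {x : EuclideanSpace ℝ (Fin 3)}
    (h : SetGood S x) (p : EuclideanSpace ℝ (Fin 3)) :
    ∃ z ∈ S, dist x z < 6 / 5 ∧ (z = x → p = x) ∧ ∃ a : ℝ, 9 / 10 ≤ a ∧ a ≤ 11 / 10 ∧
      dist z p ^ 2 ≤ dist x p ^ 2 - 1314 / 1000 * a * dist x p + 11025 / 10000 * a ^ 2 := by
  obtain ⟨a, ha9, ha11, hdir⟩ := shellDir h
  obtain ⟨z, hz, hnorm, hinner⟩ := hdir (p - x)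
  have ha0 : 0 ≤ a := by linarith
  refine ⟨z, hz, ?_, ?_, a, ha9, ha11, ?_⟩
  · rw [dist_comm, dist_eq_norm]
    linarith
  · intro hzx
    rw [hzx, sub_self, inner_zero_left] at hinner
    have h1 : ‖p - x‖ ≤ 0 := by
      nlinarith [hinner, mul_nonneg (sub_nonneg.2 ha9) (norm_nonneg (p - x)), norm_nonneg (p - x)]
    exact sub_eq_zero.1 (norm_le_zero_iff.1 h1)
  · -- adapted from `FunnelCovering.exists_step`
    have key : dist z p ^ 2 = ‖z - x‖ ^ 2 - 2 * inner ℝ (z - x) (p - x) + ‖p - x‖ ^ 2 := by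
      rw [dist_eq_norm, ← norm_sub_sq_real, sub_sub_sub_cancel_right]
    have h2 : ‖p - x‖ = dist x p := by rw [dist_comm, dist_eq_norm]
    rw [key, h2]
    rw [h2] at hinner
    nlinarith [mul_le_mul hnorm hnorm (norm_nonneg _) (by positivity), norm_nonneg (z - x)]

/-- Far from the target (`r ≥ 3/2`) a greedy step gains `3/10`. [folklore] -/
theorem step_far {r a : ℝ} (ha9 : 9 / 10 ≤ a) (ha11 : a ≤ 11 / 10) (hr : 3 / 2 ≤ r) :
    r ^ 2 - 1314 / 1000 * a * r + 11025 / 10000 * a ^ 2 ≤ (r - 3 / 10) ^ 2 := by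
  nlinarith [mul_nonneg (sub_nonneg.2 hr) (sub_nonneg.2 ha9),
    mul_nonneg (sub_nonneg.2 ha9) (sub_nonneg.2 ha11)]

/-- Near the target (`r ≤ 3/2`) a greedy step lands strictly within `6/5`. [folklore] -/
theorem step_near {r a : ℝ} (ha9 : 9 / 10 ≤ a) (ha11 : a ≤ 11 / 10) (hr0 : 0 ≤ r)
    (hr : r ≤ 3 / 2) :
    r ^ 2 - 1314 / 1000 * a * r + 11025 / 10000 * a ^ 2 < (6 / 5) ^ 2 := by
  nlinarith [mul_nonneg hr0 (sub_nonneg.2 hr), mul_nonneg (sub_nonneg.2 hr) (sub_nonneg.2 ha11),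
    mul_nonneg (sub_nonneg.2 ha9) (sub_nonneg.2 ha11)]

/-- **Greedy walks.**  Every `x ∈ S` with `dist(x, q) ≤ 3/2 + 3m/10`, `q ∈ S`, is joined to `q`
by a walk of length `≤ m + 2` in the window graph of the rescaled set. [folklore] -/
theorem exists_walk {S : Set (EuclideanSpace ℝ (Fin 3))} (hS : ∀ x ∈ S, SetGood S x)
    {q : EuclideanSpace ℝ (Fin 3)} (hq : q ∈ S) :
    ∀ m : ℕ, ∀ x ∈ S, dist x q ≤ 3 / 2 + 3 * (m : ℝ) / 10 →
      ∃ w : (windowGraph ((19 / 20 : ℝ) • S)).Walk ((19 / 20 : ℝ) • x) ((19 / 20 : ℝ) • q),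
        w.length ≤ m + 2 := by
  intro m
  induction m with
  | zero =>
    intro x hx hd
    by_cases hxq : x = q
    · subst hxq
      exact ⟨SimpleGraph.Walk.nil, by simp⟩
    obtain ⟨z, hz, hxz, hzx, a, ha9, ha11, hest⟩ := exists_bond_step (hS x hx) q
    have hxz' : x ≠ z := fun h => hxq (hzx h.symm).symm
    have hadj := adj_smul hS hx hz hxz' hxz
    have hzq : dist z q < 6 / 5 := by
      have h2 : dist z q ^ 2 < (6 / 5) ^ 2 :=
        hest.trans_lt (step_near ha9 ha11 dist_nonneg (by simpa using hd))
      exact (abs_lt_of_sq_lt_sq' h2 (by norm_num)).2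
    by_cases hzq' : z = q
    · subst hzq'
      exact ⟨SimpleGraph.Walk.cons hadj SimpleGraph.Walk.nil, by simp⟩
    · exact ⟨SimpleGraph.Walk.cons hadj
        (SimpleGraph.Walk.cons (adj_smul hS hz hq hzq' hzq) SimpleGraph.Walk.nil), by simp⟩
  | succ m ih =>
    intro x hx hd
    by_cases hle : dist x q ≤ 3 / 2 + 3 * (m : ℝ) / 10
    · obtain ⟨w, hw⟩ := ih x hx hle
      exact ⟨w, by omega⟩
    push Not at hle
    obtain ⟨z, hz, hxz, hzx, a, ha9, ha11, hest⟩ := exists_bond_step (hS x hx) q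
    have h32 : 3 / 2 ≤ dist x q := by
      have : (0 : ℝ) ≤ 3 * (m : ℝ) / 10 := by positivity
      linarith
    have hxq : x ≠ q := by
      intro h
      rw [h, dist_self] at h32
      linarith
    have hxz' : x ≠ z := fun h => hxq (hzx h.symm).symm
    have h2 : dist z q ^ 2 ≤ (dist x q - 3 / 10) ^ 2 := hest.trans (step_far ha9 ha11 h32)
    have hzq : dist z q ≤ dist x q - 3 / 10 := (abs_le_of_sq_le_sq' h2 (by linarith)).2
    have hzq' : dist z q ≤ 3 / 2 + 3 * (m : ℝ) / 10 := by
      push_cast at hd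
      linarith
    obtain ⟨w, hw⟩ := ih z hz hzq'
    exact ⟨SimpleGraph.Walk.cons (adj_smul hS hx hz hxz' hxz) w,
      by rw [SimpleGraph.Walk.length_cons]; omega⟩

/-- **Connectivity**: any two points of the rescaled set are joined by a walk in its window
graph. [folklore] -/
theorem connected {S : Set (EuclideanSpace ℝ (Fin 3))} (hS : ∀ x ∈ S, SetGood S x)
    {x y : EuclideanSpace ℝ (Fin 3)} (hx : x ∈ S) (hy : y ∈ S) :
    Nonempty ((windowGraph ((19 / 20 : ℝ) • S)).Walk ((19 / 20 : ℝ) • x) ((19 / 20 : ℝ) • y)) := by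
  obtain ⟨w, -⟩ := exists_walk hS hy ⌈4 * dist x y⌉₊ x hx
    (by have := Nat.le_ceil (4 * dist x y); linarith [dist_nonneg (x := x) (y := y)])
  exact ⟨w⟩

/-! ## Finiteness and counting -/

/-- **Bounded parts of a `0.81`-separated set are finite** (packing bound). [folklore] -/
theorem finite_inter_closedBall {A : Set (EuclideanSpace ℝ (Fin 3))}
    (hA : ∀ y ∈ A, ∀ z ∈ A, y ≠ z → (81 / 100 : ℝ) ≤ dist y z) (x : EuclideanSpace ℝ (Fin 3))
    (R : ℝ) :
    (A ∩ closedBall x R).Finite := by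
  -- adapted from `PalmUnimodularRigidityShellsToBarlowChart.finite_inter_closedBall`
  have hsep : Metric.IsSeparated ((4 / 5 : ℝ≥0) : ℝ≥0∞) (A ∩ closedBall x R) := by
    intro y hy z hz hne
    have hd := hA y hy.1 z hz.1 hne
    rw [edist_dist, ← ENNReal.ofReal_coe_nnreal]
    refine (ENNReal.ofReal_lt_ofReal_iff (dist_pos.2 hne)).2 ?_
    push_cast
    linarith
  have hfin : volume (⋃ a ∈ A ∩ closedBall x R, ball a (((4 / 5 : ℝ≥0) : ℝ) / 2)) ≠ ⊤ := by
    refine (lt_of_le_of_lt (measure_mono ?_) (measure_ball_lt_top (x := x) (r := R + 1))).ne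
    intro p hp
    obtain ⟨a, ha, hpa⟩ := Set.mem_iUnion₂.1 hp
    rw [mem_ball] at hpa ⊢
    have h1 : dist a x ≤ R := mem_closedBall.1 ha.2
    have h2 : (((4 / 5 : ℝ≥0) : ℝ) / 2) ≤ 1 := by push_cast; norm_num
    linarith [dist_triangle p a x]
  have hpack := Metric.packingNumber_ne_top_of_measure_ne_top volume (by norm_num) hfin
  have hle := Metric.IsSeparated.encard_le_packingNumber subset_rfl hsep
  exact Set.encard_ne_top_iff.1 (ne_top_of_le_ne_top hpack hle)

/-- **Window balls of the rescaled set are finite**: a walk of length `≤ n` ends in the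
rescaled set within `28n/25` of its start. [folklore] -/
theorem windowBall_finite {S : Set (EuclideanSpace ℝ (Fin 3))} (hS : ∀ x ∈ S, SetGood S x)
    {x : EuclideanSpace ℝ (Fin 3)} (hx : x ∈ S) (n : ℕ) :
    (windowBall ((19 / 20 : ℝ) • S) ((19 / 20 : ℝ) • x) n).Finite := by
  refine (finite_inter_closedBall (sep_smul hS) ((19 / 20 : ℝ) • x) (28 / 25 * n)).subset ?_
  rintro y ⟨w, hw⟩
  obtain ⟨hyS, hd⟩ := walk_mem_and_dist w (Set.smul_mem_smul_set hx)
  refine ⟨hyS, mem_closedBall.2 ?_⟩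
  rw [dist_comm]
  have : (w.length : ℝ) ≤ n := by exact_mod_cast hw
  linarith

/-- **Volume count.**  For `x ∈ S` and `R ≥ 1`, the set `S ∩ B(x, R)` has at least `(R − 1)³`
points: the unit balls about its points cover `B(x, R − 1)` (covering radius `< 1`).
[folklore] -/
theorem cube_le_ncard {S : Set (EuclideanSpace ℝ (Fin 3))} (hS : ∀ x ∈ S, SetGood S x)
    {x : EuclideanSpace ℝ (Fin 3)} (hx : x ∈ S) {R : ℝ} (hR : 1 ≤ R) :
    (R - 1) ^ 3 ≤ (Set.ncard (S ∩ closedBall x R) : ℝ) := by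
  -- adapted from `PalmUnimodularRigidityShellsToBarlowChart.cube_le_ncard`
  have hF := finite_inter_closedBall (sep hS) x R
  have hcov : closedBall x (R - 1) ⊆ ⋃ y ∈ hF.toFinset, closedBall y 1 := by
    intro p hp
    obtain ⟨y, hy, hyp⟩ := stub_funnelCovering S hS x hx p
    have hyF : y ∈ hF.toFinset := by
      rw [Set.Finite.mem_toFinset]
      refine ⟨hy, mem_closedBall.2 ?_⟩
      have := mem_closedBall.1 hp
      linarith [dist_triangle y p x]
    exact Set.mem_biUnion hyF (mem_closedBall'.2 hyp.le)
  have hvol : volume (closedBall x (R - 1)) ≤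
      ∑ y ∈ hF.toFinset, volume (closedBall y (1 : ℝ)) :=
    (measure_mono hcov).trans (measure_biUnion_finset_le _ _)
  rw [Measure.addHaar_closedBall volume x (by linarith : (0 : ℝ) ≤ R - 1),
    Finset.sum_congr rfl (fun y _ =>
      Measure.addHaar_closedBall volume y (by norm_num : (0 : ℝ) ≤ 1)),
    Finset.sum_const, nsmul_eq_mul, finrank_euclideanSpace_fin, ← mul_assoc] at hvol
  have hV0 : volume (ball (0 : EuclideanSpace ℝ (Fin 3)) 1) ≠ 0 :=
    (measure_ball_pos volume (0 : EuclideanSpace ℝ (Fin 3)) one_pos).ne'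
  have hVt : volume (ball (0 : EuclideanSpace ℝ (Fin 3)) 1) ≠ ⊤ := measure_ball_lt_top.ne
  rw [ENNReal.mul_le_mul_iff_left hV0 hVt, ← ENNReal.ofReal_natCast,
    ← ENNReal.ofReal_mul (by positivity), ENNReal.ofReal_le_ofReal_iff (by positivity)] at hvol
  rw [Set.ncard_eq_toFinset_card _ hF]
  rw [one_pow, mul_one] at hvol
  exact hvol

/-- **Cubic growth**: for `x ∈ S` and `n ≥ 2` the window ball of radius `n` about `(19/20) • x`
in the rescaled set has at least `n³/125` points. [folklore] -/
theorem growth {S : Set (EuclideanSpace ℝ (Fin 3))} (hS : ∀ x ∈ S, SetGood S x)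
    {x : EuclideanSpace ℝ (Fin 3)} (hx : x ∈ S) {n : ℕ} (hn : 2 ≤ n) :
    (1 / 125 : ℝ) * (n : ℝ) ^ 3 ≤
      (Set.ncard (windowBall ((19 / 20 : ℝ) • S) ((19 / 20 : ℝ) • x) n) : ℝ) := by
  -- the rescaled metric ball of radius `R = 3/2 + 3(n-2)/10` lies in the window ball of radius `n`
  have hsub : (fun y : EuclideanSpace ℝ (Fin 3) => (19 / 20 : ℝ) • y) ''
        (S ∩ closedBall x (3 / 2 + 3 * ((n - 2 : ℕ) : ℝ) / 10)) ⊆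
      windowBall ((19 / 20 : ℝ) • S) ((19 / 20 : ℝ) • x) n := by
    rintro _ ⟨y, ⟨hy, hyR⟩, rfl⟩
    rw [mem_closedBall, dist_comm] at hyR
    obtain ⟨w, hw⟩ := exists_walk hS hy (n - 2) x hx hyR
    exact ⟨w, by omega⟩
  have hWfin := windowBall_finite hS hx n
  have hR : (1 : ℝ) ≤ 3 / 2 + 3 * ((n - 2 : ℕ) : ℝ) / 10 := by
    have : (0 : ℝ) ≤ 3 * ((n - 2 : ℕ) : ℝ) / 10 := by positivity
    linarith
  have hcount := cube_le_ncard hS hx hR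
  have himg : ((fun y : EuclideanSpace ℝ (Fin 3) => (19 / 20 : ℝ) • y) ''
      (S ∩ closedBall x (3 / 2 + 3 * ((n - 2 : ℕ) : ℝ) / 10))).ncard =
        (S ∩ closedBall x (3 / 2 + 3 * ((n - 2 : ℕ) : ℝ) / 10)).ncard :=
    Set.ncard_image_of_injective _ smul_injective
  have hmono : ((S ∩ closedBall x (3 / 2 + 3 * ((n - 2 : ℕ) : ℝ) / 10)).ncard : ℝ) ≤
      (windowBall ((19 / 20 : ℝ) • S) ((19 / 20 : ℝ) • x) n).ncard := by
    rw [← himg]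
    exact_mod_cast Set.ncard_le_ncard hsub hWfin
  refine le_trans ?_ (hcount.trans hmono)
  have hn0 : (2 : ℝ) ≤ n := by exact_mod_cast hn
  rw [Nat.cast_sub hn]
  push_cast
  have h1 : (n : ℝ) / 5 ≤ 3 / 2 + 3 * ((n : ℝ) - 2) / 10 - 1 := by linarith
  have h2 : (1 / 125 : ℝ) * (n : ℝ) ^ 3 = ((n : ℝ) / 5) ^ 3 := by ring
  rw [h2]
  exact pow_le_pow_left₀ (by positivity) h1 3

/-! ## The stub -/

/-- **R1b `stub_goodGrowth` of line `palm-good-law`.**  CONNECTIVITY AND CUBIC GROWTH of the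
window graph of the rescaled set `S' = (19/20) • S` of an everywhere-`SetGood` set `S`: any two
points are joined by a walk, and the graph balls about each point eventually hold `≥ C·n³`
points (here `C = 1/125`, `n ≥ 2`). [folklore] -/
theorem stub_goodGrowth :
    ∀ S : Set (EuclideanSpace ℝ (Fin 3)), (∀ x ∈ S, SetGood S x) →
      (∀ x ∈ S, ∀ y ∈ S, Nonempty ((windowGraph ((19 / 20 : ℝ) • S)).Walk ((19 / 20 : ℝ) • x) ((19 / 20 : ℝ) • y))) ∧
      (∀ x ∈ S, ∃ C : ℝ, 0 < C ∧ ∃ n₀ : ℕ, ∀ n : ℕ, n₀ ≤ n →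
        C * (n : ℝ) ^ 3 ≤ (Set.ncard (windowBall ((19 / 20 : ℝ) • S) ((19 / 20 : ℝ) • x) n) : ℝ)) := by
  intro S hS
  exact ⟨fun x hx y hy => connected hS hx hy,
    fun x hx => ⟨1 / 125, by norm_num, 2, fun n hn => growth hS hx hn⟩⟩

end Summit.AtomisticToContinuum.Crystallization.Theorems.PalmGoodLaw.GoodGrowth

end
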